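import Mathlib
import HarnessLib
import Summits.NavierStokesRegularity.NavierStokesRegularity.Theorems.TaylorModelRungThreeCertificateReadoutVSoundWinPBN
import Summits.NavierStokesRegularity.NavierStokesRegularity.Theorems.TaylorModelRungThreeCertificateReadoutVSoundWinPC

/-!
# (engine-1 g70) PN TWIN of `…ReadoutVSoundWinPC`: the SAME statements and proofs with the read-out step
# `readoutStepWinPN` (full-precision reciprocals `invPosN`, `…ReadoutVLandN`/`…StepWinPN`/`…InterpWinPN`) in place of `readoutStepWinP`;
# generic helpers of the P file are imported, not re-declared.
# Crux K1b-DR (stmt-NavierStokesRegularity-23954), line `taylor-model` — v3 WINDOWED read-outs (POINCARÉ-CORRECTED) SOUNDNESS, part C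
# (ns-tm-g4 g7): the (R9p) bridge and the assembly **`readoutsVPN_of_checks'`**

* `abs_sub_le_of_inBox_hull0` — a level-0 hull point `y₀` at node `S−1` is within `ρ0 = rho0 j` of the centre `xD j (S−1)`, coordinatewise;
* `readoutWPN_R9p` — **(R9p)** of `ReadoutsVP` at stage `j`: for the centre crossing state `yc ∈ Z⁰c ∩ {σf = lev}`, a crossing state
  `y₁ ∈ Z¹ ∩ {σf = lev}`, an in-step kernel `Ak` at a time of the level-1 window, a level-0 hull point `y₀` and admissible tails,
  `|ℓ(land yc v) − ctr| + |ℓ(landD y₁ v (secCorr y₁ (kapp Ak (y₀ − x))))| + β ≤ rad − s` — by `readoutStepWinPN_R9p` with the window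
  matrix of `Ak` in `MinW` (`inStepMW_memMat`), the displacement `d = wv y₀ − xD` bounded by `ρ0`, and `z = kapp Ak (y₀ − x)`;
* `readoutsVPN_of_checks' : KitOK → checkReadoutsWinPN' = true → (R4 per sub-step) → (R0)…(R3) (composer's clauses) → (entry box) →
  ReadoutsVP (toCertDataVW …) (toBoxesW …) (toRadiiW …) (toReadoutDataWinP … G ΛT) (toWinDataP …)` — the 25 clauses in order.

HONEST FRAMING: kernel bookkeeping for the MODEL certificate №23954 (rung TL-M3); nothing here is a statement about the
Navier–Stokes equations.
-/

-- the sub-problem namespace repeats the summit name by design (D-0017)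
set_option linter.dupNamespace false

namespace Summit.NavierStokesRegularity.NavierStokesRegularity.Theorems.TaylorModelCert

open scoped BigOperators
open Set
open Literature.Analysis.FluidPDE.TaoCascade Literature.Analysis.FluidPDE.TaoCascade.TaylorChain
open Summit.NavierStokesRegularity.NavierStokesRegularity.Theorems.TaylorModelReadout
open Summit.NavierStokesRegularity.NavierStokesRegularity.Theorems.TaylorModelV

namespace CertTablesV

variable {TV : CertTablesV} {kitOf : ℕ → CoreKit} {wT : ℕ → Array Dyad} {sc : ScalarsV} {A : ReadoutAux QS2} {WV : WindowsV}

/-! ### (R9p) the Poincaré-corrected base landing -/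


/-- **(R9p)** of `ReadoutsVP` at stage `j` (see the module docstring). [folklore] -/
theorem readoutWPN_R9p (hk : KitOK TV kitOf) (hA : TV.base.checkReadoutAux A = true) {j : ℕ} (hok : (TV.roOutWinPN kitOf wT A WV j).ok = true) :
    ∀ yc, InBox (TV.toCertDataVW kitOf wT sc) ((TV.toWinDataP kitOf wT A WV).zlo 0 j) ((TV.toWinDataP kitOf wT A WV).zhi 0 j) yc →
      (TV.toCertDataVW kitOf wT sc).σf j yc = (TV.toCertDataVW kitOf wT sc).lev j →
      ∀ y₁, InBox (TV.toCertDataVW kitOf wT sc) ((TV.toWinDataP kitOf wT A WV).zlo 1 j) ((TV.toWinDataP kitOf wT A WV).zhi 1 j) y₁ →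
      (TV.toCertDataVW kitOf wT sc).σf j y₁ = (TV.toCertDataVW kitOf wT sc).lev j →
      ∀ u ∈ Icc ((TV.toWinDataP kitOf wT A WV).ulo 1 j) ((TV.toWinDataP kitOf wT A WV).uhi 1 j), ∀ Ak : Ker,
      InStepKer (TV.toCertDataVW kitOf wT sc) (TV.toBoxesW kitOf wT) j ((TV.toCertDataVW kitOf wT sc).S j - 1) u Ak →
      ∀ y₀, InBox (TV.toCertDataVW kitOf wT sc) ((TV.toBoxesW kitOf wT).hlo 0 j ((TV.toCertDataVW kitOf wT sc).S j - 1))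
          ((TV.toBoxesW kitOf wT).hhi 0 j ((TV.toCertDataVW kitOf wT sc).S j - 1)) y₀ →
      ∀ v, TailOK (TV.toCertDataVW kitOf wT sc) v → ∀ l,
      |(TV.toCertDataVW kitOf wT sc).ℓ ((TV.toCertDataVW kitOf wT sc).nx j) l ((TV.toCertDataVW kitOf wT sc).land j yc v) -
          (TV.toCertDataVW kitOf wT sc).ctr ((TV.toCertDataVW kitOf wT sc).nx j) l| +
        |(TV.toCertDataVW kitOf wT sc).ℓ ((TV.toCertDataVW kitOf wT sc).nx j) l
          ((TV.toCertDataVW kitOf wT sc).landD j y₁ v (secCorr (TV.toCertDataVW kitOf wT sc) j y₁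
            (kapp (TV.toCertDataVW kitOf wT sc) Ak (y₀ - (TV.toCertDataVW kitOf wT sc).x j ((TV.toCertDataVW kitOf wT sc).S j - 1)))))| +
        (TV.toCertDataVW kitOf wT sc).β j l ≤
        (TV.toCertDataVW kitOf wT sc).rad ((TV.toCertDataVW kitOf wT sc).nx j) l - (TV.toCertDataVW kitOf wT sc).s ((TV.toCertDataVW kitOf wT sc).nx j) l := by
  intro yc hyc _ y₁ hy₁ _ u hu Ak hAk y₀ hy₀ v hv l
  rw [rwP_zlo0, rwP_zhi0] at hyc
  rw [rwP_zlo1, rwP_zhi1] at hy₁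
  rw [rwP_ulo1, rwP_uhi1] at hu
  set s := (TV.base.stage j).S - 1 with hs
  have hSs : (TV.toCertDataVW kitOf wT sc).S j - 1 = s := rfl
  rw [hSs] at hAk hy₀ ⊢
  have hw := TV.base.readoutStepWinPN_win (TV.roInWinP kitOf wT A WV j) hok
  have hu0 : 0 ≤ u := hw.1.trans hu.1
  -- the window matrix of `Ak` lies in `MinW`
  have ha : MemMat TV.base.n (fun r c => Ak (TV.base.wi r) (TV.base.wk r) (TV.base.wi c) (TV.base.wk c))
      ((TV.roInWin kitOf wT A WV j).MinW TV.base) :=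
    TV.base.inStepMW_memMat hk.coef (hk.box j) _ _ (size_hullBox 2 j s) hu0 hu.1 hu.2 _
      (fun i k h1 h2 => mem_ωinvB j i k h1 h2) (inStep_window hAk)
  -- the displacement `d = wv y₀ − xD` and `z = kapp Ak (y₀ − x)`
  have hρ : ∀ c < TV.base.n, |(fun c => TV.base.wv y₀ c - vre (TV.xD j s) c) c| ≤ (dget (TV.rho0 kitOf wT j) c).toReal :=
    fun c hc => abs_sub_le_of_inBox_hull0 hy₀ hc
  have hz : ∀ b < TV.base.n, TV.base.wv (kapp (TV.toCertDataVW kitOf wT sc) Ak (y₀ - (TV.toCertDataVW kitOf wT sc).x j s)) b =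
      ∑ c ∈ Finset.range TV.base.n, (fun r c => Ak (TV.base.wi r) (TV.base.wk r) (TV.base.wi c) (TV.base.wk c)) b c *
        (fun c => TV.base.wv y₀ c - vre (TV.xD j s) c) c := by
    intro b hb
    rw [wv_kapp Ak _ hb]
    refine Finset.sum_congr rfl fun c hc => ?_
    show _ = Ak (TV.base.wi b) (TV.base.wk b) (TV.base.wi c) (TV.base.wk c) * (TV.base.wv y₀ c - vre (TV.xD j s) c)
    congr 1
    rw [← TV.base.wv_vecF (vre (TV.xD j s)) (Finset.mem_range.1 hc)]
    rfl
  rw [cd_nx, cd_ell, cd_land, cd_landD, cd_secCorr, cd_ctr, cd_beta, cd_rad, cd_sl]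
  by_cases hl : l < TV.nF j
  · rw [TV.base.covR_apply QS2.toRealHom _ (TV.base.landDF _ y₁ v _)]
    exact TV.base.readoutStepWinPN_R9p (TV.roInWinP kitOf wT A WV j) hok (mem_faceB _ _) (mem_listB _ _) (mem_listB _ _) (mem_listB _ _)
      (mem_listB _ _) (IntervalD.mem_ofQS2 _ _) (tail_le (kitOf := kitOf) (wT := wT) (sc := sc) hA hv) (memVec_of_inBox_loR hyc)
      (memVec_of_inBox_loR hy₁) (mem_covB _) hk.coef (hk.box j) (hk.mt j) ha hρ hz hl
  · rw [not_lt] at hl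
    obtain ⟨h1, h2, h3, h4, h5⟩ := lengths_le_nF (TV := TV) j
    rw [List.getD_eq_default _ _ (le_trans h1 hl), TV.base.covR_nil, TV.base.covR_nil, vget_of_le _ (le_trans h2 hl),
      vget_of_le _ (le_trans h3 hl), vget_of_le _ (le_trans h4 hl), vget_of_le _ (le_trans h5 hl)]
    simp

/-! ### Assembly -/

/-- **The POINCARÉ-CORRECTED windowed read-outs of the interpreted v3 certificate from the read-out checks**: as
`readoutsVW_of_checks'`, with `checkReadoutsWinPN' kitOf wT A WV = true` (P read-out steps, checkpoint form), the per-sub-step (R4)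
Booleans `hR4` (from the chunk runs), the composer's (R0)–(R3), and the ENTRY box of the polytope parametrisation; the records are
`toReadoutDataWinP` (fat `Y` boxes + windowed kernel box) and `toWinDataP` (windows; `Z⁰c`, `Z¹`). [folklore] -/
theorem readoutsVPN_of_checks' (hk : KitOK TV kitOf) (hchk' : TV.checkReadoutsWinPN' kitOf wT A WV = true)
    (hR4 : ∀ j, j ≤ TV.base.N₀ → ∀ s, s < (TV.base.stage j).S →
      TV.base.testR4 TV.MB (TV.AB j) (TV.coreVW kitOf wT j s) = true)
    {G : ℕ → ℕ → ℕ → ℝ} {ΛT : ℕ → ℝ}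
    (hR0 : ∀ j, j ≤ TV.base.N₀ →
      (TV.toCertDataVW kitOf wT sc).Tn j ((TV.toCertDataVW kitOf wT sc).S j) ≤ (TV.toCertDataVW kitOf wT sc).τs ∧
      InPoly (TV.toCertDataVW kitOf wT sc) j ((TV.toCertDataVW kitOf wT sc).x j 0) ∧ 0 < (TV.toCertDataVW kitOf wT sc).γ j ∧
      0 ≤ (TV.toReadoutDataWinP kitOf wT A WV G ΛT).ΛT j ∧
      (∀ y : Fin 4 → ℤ → ℝ, (TV.toCertDataVW kitOf wT sc).σf j y = (TV.toCertDataVW kitOf wT sc).σf j (trunc (TV.toCertDataVW kitOf wT sc) y)))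
    (hR1 : ∀ j, j ≤ TV.base.N₀ → ∀ s', s' ≤ (TV.toCertDataVW kitOf wT sc).S j → ∀ y d : Fin 4 → ℤ → ℝ,
      InBox (TV.toCertDataVW kitOf wT sc) ((TV.toBoxesW kitOf wT).hlo 1 j s') ((TV.toBoxesW kitOf wT).hhi 1 j s') y →
      (TV.toCertDataVW kitOf wT sc).InBall j d ((TV.toReadoutDataWinP kitOf wT A WV G ΛT).ΛT j * (TV.toCertDataVW kitOf wT sc).κ j) →
      InBox (TV.toCertDataVW kitOf wT sc) ((TV.toBoxesW kitOf wT).hlo 2 j s') ((TV.toBoxesW kitOf wT).hhi 2 j s') (y + d))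
    (hR2 : ∀ j, j ≤ TV.base.N₀ → ∀ s₀ s₁, s₀ ≤ s₁ → s₁ ≤ (TV.toCertDataVW kitOf wT sc).S j → ∀ Ac : ℕ → Ker,
      (∀ s', s₀ ≤ s' → s' < s₁ → KerMem (TV.toCertDataVW kitOf wT sc) (Ac s') ((TV.toBoxesW kitOf wT).Mlo j s') ((TV.toBoxesW kitOf wT).Mhi j s')) →
      ∀ (v : Fin 4 → ℤ → ℝ) (r : ℝ), 0 ≤ r → (TV.toCertDataVW kitOf wT sc).InBall j v r →
        (TV.toCertDataVW kitOf wT sc).InBall j (kiter (TV.toCertDataVW kitOf wT sc) Ac s₀ (s₁ - s₀) v) ((TV.toReadoutDataWinP kitOf wT A WV G ΛT).G j s₀ s₁ * r))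
    (hR3a : ∀ j, j ≤ TV.base.N₀ → ∀ a b, a < (TV.toCertDataVW kitOf wT sc).S j → a + 1 ≤ b → b ≤ (TV.toCertDataVW kitOf wT sc).S j →
      (TV.toCertDataVW kitOf wT sc).L1 j a * (TV.toReadoutDataWinP kitOf wT A WV G ΛT).G j (a + 1) b ≤ (TV.toReadoutDataWinP kitOf wT A WV G ΛT).ΛT j ∧
      (b < (TV.toCertDataVW kitOf wT sc).S j →
        (TV.toCertDataVW kitOf wT sc).L1 j a * (TV.toReadoutDataWinP kitOf wT A WV G ΛT).G j (a + 1) b * (TV.toCertDataVW kitOf wT sc).L1 j b ≤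
          (TV.toCertDataVW kitOf wT sc).Λ j))
    (hR3b : ∀ j, j ≤ TV.base.N₀ → ∀ a, a < (TV.toCertDataVW kitOf wT sc).S j → (TV.toCertDataVW kitOf wT sc).L1 j a ≤ (TV.toCertDataVW kitOf wT sc).Λ j)
    (hentry : ∀ j, j ≤ TV.base.N₀ → ∀ q ζ : Fin 4 → ℤ → ℝ, InPoly (TV.toCertDataVW kitOf wT sc) j q →
      (∀ i k, -(TV.toCertDataVW kitOf wT sc).Kb ≤ k → k ≤ (TV.toCertDataVW kitOf wT sc).Ka →
        q i k = ((TV.toCertDataVW kitOf wT sc).x j 0 + (TV.toRadiiW kitOf wT).Dsc j ζ) i k) →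
      ∀ c < TV.base.n, |TV.base.wv ζ c| ≤ (dget (TV.stageV j).rB c).toReal) :
    ReadoutsVP (TV.toCertDataVW kitOf wT sc) (TV.toBoxesW kitOf wT) (TV.toRadiiW kitOf wT) (TV.toReadoutDataWinP kitOf wT A WV G ΛT)
      (TV.toWinDataP kitOf wT A WV) := by
  intro j hj
  have hjN : j ≤ TV.base.N₀ := hj
  unfold checkReadoutsWinPN' at hchk'
  simp only [Bool.and_eq_true] at hchk'
  obtain ⟨hAux, hall⟩ := hchk'
  have hok : (TV.roOutWinPN kitOf wT A WV j).ok = true := by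
    rw [← checkReadoutStageWinPN'_eq]
    exact (allN_eq_true.1 hall) j (Nat.lt_succ_of_le hjN)
  have h4 : allN (TV.base.stage j).S (fun s => TV.base.testR4 TV.MB (TV.AB j) (TV.coreVW kitOf wT j s)) = true :=
    allN_eq_true.2 fun s hs => hR4 j hjN s hs
  obtain ⟨h0a, h0b, h0c, h0d, h0e⟩ := hR0 j hjN
  exact ⟨h0a, h0b, h0c, h0d, h0e, hR1 j hjN, hR2 j hjN, hR3a j hjN, hR3b j hjN, readout_R4 h4, (readoutWPN_R5 hok).1, (readoutWPN_R5 hok).2,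
    readoutWP_R6 hk, readoutWPN_R7 hk hok, readoutWPN_R8 hAux hok, readoutWPN_R9p hk hAux hok, readoutWPN_R10 hk hok,
    readoutWPN_R11 hk hAux hok (hentry j hjN), readoutWPN_W1 hok, readoutWPN_W2 hk hok, readoutWPN_W3 hk hok, readoutWPN_W4 hk hok,
    readoutWPN_Wc2 hk hok, readoutWPN_Wc3 hk hok, readoutWPN_Wc4 hk hok⟩

end CertTablesV

end Summit.NavierStokesRegularity.NavierStokesRegularity.Theorems.TaylorModelCert
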